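import Summits.CriticalPhenomena.SAWScalingLimit.Theorems.SAWDefectDecoherenceBoundaryClosureRSqueezeSandwich
import HarnessLib

/-!
# Crux `BoundaryClosureR` (stmt-CriticalPhenomena-14004), line `polygon-parity-squeeze`,
# stub `stub_squeeze`: the PROFILE PINCH of the squeeze (mechanism (B)), one mesh and in the limit

Landing target:
`Summits/CriticalPhenomena/SAWScalingLimit/Theorems/SAWDefectDecoherenceBoundaryClosureRSqueezeProfilePinch.lean`
(`--supports stmt-CriticalPhenomena-14004`).

The normalised gate functional of `GateProfileAt`,
`T_Λ(g) = δ Σ_{e ∈ ∂Λ, δ·mid e ∈ B(c, r)} g(δ·mid e) F⁰_Λ(e) / F⁰_Λ(b)` (`F⁰ =` the `σ = 0`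
observable rooted at `a`), compared between two domains `Λ`, `Λ'` that carry the SAME exact
half-lattice `{m ≤ v.1 1}` on a ball `B(c, r₂) ⊇ B̄(c, r + δ/2)` (so both windows are the floor
mid-edges of the row `m` with scaled midpoint in `B(c, r)`, `GateMass.boundaryWindow_eq_image`) and
whose masses towards the window and towards `b` are pinched, `(1 - ε) Z_Λ ≤ Z_{Λ'} ≤ Z_Λ`:

* `profile_pinch_at` (one mesh): `‖T_Λ(g) - T_{Λ'}(g)‖ ≤ (ε / (1 - ε)²) ‖T_{Λ'}(|g|)‖`, where
  `|g|` is the test function `z ↦ ↑‖g z‖` (the summed ratio pinch of `…SqueezeSandwich.lean`);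
* `eventually_dist_lt_of_pinch` (in the limit): if eventually `‖T δ - T' δ‖ ≤ θ ‖S' δ‖`,
  `T' → I'`, `S' → J'`, `θ (‖J'‖ + 1) ≤ κ/4` and `‖I' - I‖ ≤ κ/4`, then eventually
  `dist (T δ) I < κ` — the three-epsilon step of the squeeze.

Sources: H. Duminil-Copin, S. Smirnov, Ann. of Math. 175 (2012), §3 (boundary part of the strip);
G. Lawler, O. Schramm, W. Werner (2004) §3.4.  Everything here is proved; no definition.
-/

noncomputable section

open scoped BigOperators Topology
open Filter Set
open Literature.Probability.LatticeModels (HexVertex hexGraph hexCenter Site)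
open Literature.Probability.RandomPlanarGeometry
open Literature.Probability.RandomPlanarGeometry.SAW
open Summit.CriticalPhenomena.SAWScalingLimit.Theorems.PickHalfPlane

namespace Summit.CriticalPhenomena.SAWScalingLimit.Theorems.PolygonParitySqueeze

/-! ### 1. One mesh -/

/-- **The profile pinch at one mesh.** Two domains `Λ`, `Λ'` with the same exact half-lattice
`{m ≤ v.1 1}` on `B(c, r₂)`, a window `B(c, r)` with `dist z c + δ/2 < r₂` on it, a common root
`a` and normaliser `b` with `Z_Λ(a → b) > 0`, and pinched masses `(1 - ε) Z_Λ ≤ Z_{Λ'} ≤ Z_Λ`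
towards `b` and towards every boundary mid-edge of `Λ` with scaled midpoint in the window
(`0 ≤ ε < 1`): then for every weight `g`,
`‖T_Λ(g) - T_{Λ'}(g)‖ ≤ (ε / (1 - ε)²) · ‖T_{Λ'}(|g|)‖`.
[cite: DuminilCopinSmirnov2012, §3 (the boundary part α of the strip)] -/
theorem profile_pinch_at {Λ Λ' : Finset HexVertex} {m : ℤ} {δ r r₂ ε : ℝ} {c : ℂ}
    {a b : Sym2 HexVertex} (g : ℂ → ℂ) (hδ : 0 ≤ δ) (hε₀ : 0 ≤ ε) (hε : ε < 1)
    (hpin : ∀ v : HexVertex, (δ : ℂ) * hexCenter v ∈ Metric.ball c r₂ → (v ∈ Λ ↔ m ≤ v.1 1))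
    (hpin' : ∀ v : HexVertex, (δ : ℂ) * hexCenter v ∈ Metric.ball c r₂ → (v ∈ Λ' ↔ m ≤ v.1 1))
    (hS : ∀ z ∈ Metric.ball c r, dist z c + δ / 2 < r₂)
    (hb : 0 < ‖hexParafermionicObservable Λ a hexCriticalFugacity 0 b‖)
    (hb₁ : (1 - ε) * ‖hexParafermionicObservable Λ a hexCriticalFugacity 0 b‖ ≤
      ‖hexParafermionicObservable Λ' a hexCriticalFugacity 0 b‖)
    (hb₂ : ‖hexParafermionicObservable Λ' a hexCriticalFugacity 0 b‖ ≤
      ‖hexParafermionicObservable Λ a hexCriticalFugacity 0 b‖)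
    (hsand : ∀ z ∈ hexDomainBoundary Λ, (δ : ℂ) * hexMidpoint z ∈ Metric.ball c r →
      (1 - ε) * ‖hexParafermionicObservable Λ a hexCriticalFugacity 0 z‖ ≤
          ‖hexParafermionicObservable Λ' a hexCriticalFugacity 0 z‖ ∧
        ‖hexParafermionicObservable Λ' a hexCriticalFugacity 0 z‖ ≤
          ‖hexParafermionicObservable Λ a hexCriticalFugacity 0 z‖) :
    ‖(δ : ℂ) * (∑ᶠ e ∈ {e : Sym2 HexVertex | e ∈ hexDomainBoundary Λ ∧
          (δ : ℂ) * hexMidpoint e ∈ Metric.ball c r},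
          g ((δ : ℂ) * hexMidpoint e) *
            (hexParafermionicObservable Λ a hexCriticalFugacity 0 e /
              hexParafermionicObservable Λ a hexCriticalFugacity 0 b)) -
      (δ : ℂ) * (∑ᶠ e ∈ {e : Sym2 HexVertex | e ∈ hexDomainBoundary Λ' ∧
          (δ : ℂ) * hexMidpoint e ∈ Metric.ball c r},
          g ((δ : ℂ) * hexMidpoint e) *
            (hexParafermionicObservable Λ' a hexCriticalFugacity 0 e /
              hexParafermionicObservable Λ' a hexCriticalFugacity 0 b))‖ ≤
      ε / (1 - ε) ^ 2 * ‖(δ : ℂ) * (∑ᶠ e ∈ {e : Sym2 HexVertex | e ∈ hexDomainBoundary Λ' ∧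
          (δ : ℂ) * hexMidpoint e ∈ Metric.ball c r},
          ((‖g ((δ : ℂ) * hexMidpoint e)‖ : ℝ) : ℂ) *
            (hexParafermionicObservable Λ' a hexCriticalFugacity 0 e /
              hexParafermionicObservable Λ' a hexCriticalFugacity 0 b))‖ := by
  -- abbreviations
  set fe : ℤ → Sym2 HexVertex := fun k =>
    s((((![k, m - 1] : Site 2)), (1 : Fin 2)), ((![k, m] : Site 2), (0 : Fin 2))) with hfe
  set K : Set ℤ := {k : ℤ | (δ : ℂ) * hexMidpoint (fe k) ∈ Metric.ball c r} with hK
  set A : ℤ → ℝ := fun k => ‖hexParafermionicObservable Λ a hexCriticalFugacity 0 (fe k)‖ with hA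
  set A' : ℤ → ℝ := fun k => ‖hexParafermionicObservable Λ' a hexCriticalFugacity 0 (fe k)‖ with hA'
  set B : ℝ := ‖hexParafermionicObservable Λ a hexCriticalFugacity 0 b‖ with hB
  set B' : ℝ := ‖hexParafermionicObservable Λ' a hexCriticalFugacity 0 b‖ with hB'
  set w : ℤ → ℂ := fun k => g ((δ : ℂ) * hexMidpoint (fe k)) with hw
  have hWΛ := GateMass.boundaryWindow_eq_image (S := Metric.ball c r) hδ hpin hS
  have hWΛ' := GateMass.boundaryWindow_eq_image (S := Metric.ball c r) hδ hpin' hS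
  have hKfin : K.Finite := GateMass.finite_intWindow (S := Metric.ball c r) hδ hpin hS
  have hinj := (GateMass.floorEdge_injective m).injOn (s := K)
  -- the three window sums as finite sums over the integer window
  have hsumΛ : ∑ᶠ e ∈ {e : Sym2 HexVertex | e ∈ hexDomainBoundary Λ ∧
      (δ : ℂ) * hexMidpoint e ∈ Metric.ball c r}, g ((δ : ℂ) * hexMidpoint e) *
        (hexParafermionicObservable Λ a hexCriticalFugacity 0 e /
          hexParafermionicObservable Λ a hexCriticalFugacity 0 b) =
      ∑ k ∈ hKfin.toFinset, w k * ((A k / B : ℝ) : ℂ) := by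
    rw [hWΛ, finsum_mem_image hinj, finsum_mem_eq_finite_toFinset_sum _ hKfin]
    refine Finset.sum_congr rfl fun k _ => ?_
    rw [obs_zero_div_eq_ofReal]
  have hsumΛ' : ∑ᶠ e ∈ {e : Sym2 HexVertex | e ∈ hexDomainBoundary Λ' ∧
      (δ : ℂ) * hexMidpoint e ∈ Metric.ball c r}, g ((δ : ℂ) * hexMidpoint e) *
        (hexParafermionicObservable Λ' a hexCriticalFugacity 0 e /
          hexParafermionicObservable Λ' a hexCriticalFugacity 0 b) =
      ∑ k ∈ hKfin.toFinset, w k * ((A' k / B' : ℝ) : ℂ) := by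
    rw [hWΛ', finsum_mem_image hinj, finsum_mem_eq_finite_toFinset_sum _ hKfin]
    refine Finset.sum_congr rfl fun k _ => ?_
    rw [obs_zero_div_eq_ofReal]
  have hsumAbs : ∑ᶠ e ∈ {e : Sym2 HexVertex | e ∈ hexDomainBoundary Λ' ∧
      (δ : ℂ) * hexMidpoint e ∈ Metric.ball c r}, ((‖g ((δ : ℂ) * hexMidpoint e)‖ : ℝ) : ℂ) *
        (hexParafermionicObservable Λ' a hexCriticalFugacity 0 e /
          hexParafermionicObservable Λ' a hexCriticalFugacity 0 b) =
      ((∑ k ∈ hKfin.toFinset, ‖w k‖ * (A' k / B') : ℝ) : ℂ) := by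
    rw [hWΛ', finsum_mem_image hinj, finsum_mem_eq_finite_toFinset_sum _ hKfin, Complex.ofReal_sum]
    refine Finset.sum_congr rfl fun k _ => ?_
    rw [obs_zero_div_eq_ofReal, Complex.ofReal_mul]
  -- pointwise pinch data on the window
  have hwin : ∀ k ∈ hKfin.toFinset, fe k ∈ hexDomainBoundary Λ ∧
      (δ : ℂ) * hexMidpoint (fe k) ∈ Metric.ball c r := by
    intro k hk
    have hk' : k ∈ K := hKfin.mem_toFinset.1 hk
    have : fe k ∈ {e : Sym2 HexVertex | e ∈ hexDomainBoundary Λ ∧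
        (δ : ℂ) * hexMidpoint e ∈ Metric.ball c r} := by
      rw [hWΛ]; exact Set.mem_image_of_mem _ hk'
    exact this
  have h1ε : 0 < 1 - ε := by linarith
  have hB'pos : 0 < B' := lt_of_lt_of_le (mul_pos h1ε hb) hb₁
  have hAk : ∀ k ∈ hKfin.toFinset, 0 ≤ A k ∧ (1 - ε) * A k ≤ A' k ∧ A' k ≤ A k := fun k hk =>
    ⟨norm_nonneg _, (hsand _ (hwin k hk).1 (hwin k hk).2).1, (hsand _ (hwin k hk).1 (hwin k hk).2).2⟩
  -- the difference
  have hdiff : ‖∑ k ∈ hKfin.toFinset, w k * ((A k / B : ℝ) : ℂ) -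
      ∑ k ∈ hKfin.toFinset, w k * ((A' k / B' : ℝ) : ℂ)‖ ≤
        ε / (1 - ε) * ∑ k ∈ hKfin.toFinset, ‖w k‖ * (A k / B) := by
    rw [norm_sub_rev]
    exact norm_sum_ratio_pinch_le hKfin.toFinset w A A' hε₀ hε hb hb₁ hb₂ hAk
  -- the upper transfer `Σ ‖w‖ A/B ≤ (1-ε)⁻¹ Σ ‖w‖ A'/B'`
  have hup : ∑ k ∈ hKfin.toFinset, ‖w k‖ * (A k / B) ≤
      (1 - ε)⁻¹ * ∑ k ∈ hKfin.toFinset, ‖w k‖ * (A' k / B') := by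
    refine sum_pinch_upper hKfin.toFinset w (fun k => A k / B) (fun k => A' k / B') hε fun k hk => ?_
    obtain ⟨h0, h1, -⟩ := hAk k hk
    exact ratio_pinch_lower hε.le h0 h1 hB'pos hb₂
  have hpos : 0 ≤ ∑ k ∈ hKfin.toFinset, ‖w k‖ * (A' k / B') :=
    Finset.sum_nonneg fun k _ => mul_nonneg (norm_nonneg _) (div_nonneg (norm_nonneg _) hB'pos.le)
  -- assemble
  rw [hsumΛ, hsumΛ', hsumAbs, ← mul_sub, norm_mul, norm_mul, Complex.norm_real, Complex.norm_real,
    Real.norm_of_nonneg hδ, Real.norm_of_nonneg hpos]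
  have hεq : 0 ≤ ε / (1 - ε) := div_nonneg hε₀ h1ε.le
  calc δ * ‖∑ k ∈ hKfin.toFinset, w k * ((A k / B : ℝ) : ℂ) -
        ∑ k ∈ hKfin.toFinset, w k * ((A' k / B' : ℝ) : ℂ)‖
      ≤ δ * (ε / (1 - ε) * ((1 - ε)⁻¹ * ∑ k ∈ hKfin.toFinset, ‖w k‖ * (A' k / B'))) := by
        refine mul_le_mul_of_nonneg_left (hdiff.trans ?_) hδ
        exact mul_le_mul_of_nonneg_left hup hεq
    _ = ε / (1 - ε) ^ 2 * (δ * ∑ k ∈ hKfin.toFinset, ‖w k‖ * (A' k / B')) := by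
        field_simp

/-! ### 2. In the limit -/

/-- **Three-epsilon step of the squeeze.** If eventually `‖T δ - T' δ‖ ≤ θ ‖S' δ‖` (`0 ≤ θ`), the
comparison functionals converge, `T' → I'` and `S' → J'`, and the constants satisfy
`θ (‖J'‖ + 1) ≤ κ/4`, `‖I' - I‖ ≤ κ/4` (`κ > 0`), then eventually `dist (T δ) I < κ`. [folklore] -/
theorem eventually_dist_lt_of_pinch {T T' S' : ℝ → ℂ} {I I' J' : ℂ} {θ κ : ℝ} (hκ : 0 < κ)
    (hθ : 0 ≤ θ) (hpinch : ∀ᶠ δ : ℝ in 𝓝[>] 0, ‖T δ - T' δ‖ ≤ θ * ‖S' δ‖)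
    (hT' : Tendsto T' (𝓝[>] 0) (𝓝 I')) (hS' : Tendsto S' (𝓝[>] 0) (𝓝 J'))
    (h1 : θ * (‖J'‖ + 1) ≤ κ / 4) (h2 : ‖I' - I‖ ≤ κ / 4) :
    ∀ᶠ δ : ℝ in 𝓝[>] 0, dist (T δ) I < κ := by
  have hT'ev : ∀ᶠ δ : ℝ in 𝓝[>] 0, dist (T' δ) I' < κ / 4 :=
    Metric.tendsto_nhds.1 hT' _ (by linarith)
  have hS'ev : ∀ᶠ δ : ℝ in 𝓝[>] 0, dist (S' δ) J' < 1 := Metric.tendsto_nhds.1 hS' _ one_pos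
  filter_upwards [hpinch, hT'ev, hS'ev] with δ hp hT hS
  have hSn : ‖S' δ‖ ≤ ‖J'‖ + 1 := by
    have := norm_le_norm_add_norm_sub' (S' δ) J'
    rw [← dist_eq_norm] at this
    linarith
  rw [dist_eq_norm] at hT ⊢
  calc ‖T δ - I‖ = ‖(T δ - T' δ) + (T' δ - I') + (I' - I)‖ := by ring_nf
    _ ≤ ‖T δ - T' δ‖ + ‖T' δ - I'‖ + ‖I' - I‖ := norm_add₃_le
    _ < κ := by nlinarith [mul_le_mul_of_nonneg_left hSn hθ]

/-- **The squeeze limit.** If for every `κ > 0` there are comparison functionals `T'`, `S'` with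
limits `I'`, `J'` and a constant `θ ≥ 0` as in `eventually_dist_lt_of_pinch`, then `T → I`.
[folklore] -/
theorem tendsto_of_pinch {T : ℝ → ℂ} {I : ℂ}
    (h : ∀ κ : ℝ, 0 < κ → ∃ (T' S' : ℝ → ℂ) (I' J' : ℂ) (θ : ℝ), 0 ≤ θ ∧
      (∀ᶠ δ : ℝ in 𝓝[>] 0, ‖T δ - T' δ‖ ≤ θ * ‖S' δ‖) ∧
      Tendsto T' (𝓝[>] 0) (𝓝 I') ∧ Tendsto S' (𝓝[>] 0) (𝓝 J') ∧
      θ * (‖J'‖ + 1) ≤ κ / 4 ∧ ‖I' - I‖ ≤ κ / 4) :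
    Tendsto T (𝓝[>] 0) (𝓝 I) := by
  rw [Metric.tendsto_nhds]
  intro κ hκ
  obtain ⟨T', S', I', J', θ, hθ, hpinch, hT', hS', h1, h2⟩ := h κ hκ
  exact eventually_dist_lt_of_pinch hκ hθ hpinch hT' hS' h1 h2

/-! ### Registered form (sub-goal of `stub_squeeze`) -/

/-- **Registered sub-goal `squeeze_profilePinch`** (crux item stmt-CriticalPhenomena-14004, line
`polygon-parity-squeeze`, stub `stub_squeeze`): the one-mesh profile pinch `profile_pinch_at` —
for two domains with the same exact gate half-lattice and masses pinched by `(1 - ε)`, the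
normalised gate functionals differ by at most `(ε / (1 - ε)²)` times the functional of `|g|`.
[cite: DuminilCopinSmirnov2012, §3 (the boundary part α of the strip)] -/
theorem squeeze_profilePinch : ∀ (Λ Λ' : Finset HexVertex) (m : ℤ) (δ r r₂ ε : ℝ) (c : ℂ) (a b : Sym2 HexVertex) (g : ℂ → ℂ), 0 ≤ δ → 0 ≤ ε → ε < 1 → (∀ v : HexVertex, (δ : ℂ) * hexCenter v ∈ Metric.ball c r₂ → (v ∈ Λ ↔ m ≤ v.1 1)) → (∀ v : HexVertex, (δ : ℂ) * hexCenter v ∈ Metric.ball c r₂ → (v ∈ Λ' ↔ m ≤ v.1 1)) → (∀ z ∈ Metric.ball c r, dist z c + δ / 2 < r₂) → 0 < ‖hexParafermionicObservable Λ a hexCriticalFugacity 0 b‖ → (1 - ε) * ‖hexParafermionicObservable Λ a hexCriticalFugacity 0 b‖ ≤ ‖hexParafermionicObservable Λ' a hexCriticalFugacity 0 b‖ → ‖hexParafermionicObservable Λ' a hexCriticalFugacity 0 b‖ ≤ ‖hexParafermionicObservable Λ a hexCriticalFugacity 0 b‖ → (∀ z ∈ hexDomainBoundary Λ, (δ : ℂ)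 * hexMidpoint z ∈ Metric.ball c r → (1 - ε) * ‖hexParafermionicObservable Λ a hexCriticalFugacity 0 z‖ ≤ ‖hexParafermionicObservable Λ' a hexCriticalFugacity 0 z‖ ∧ ‖hexParafermionicObservable Λ' a hexCriticalFugacity 0 z‖ ≤ ‖hexParafermionicObservable Λ a hexCriticalFugacity 0 z‖) → ‖(δ : ℂ) * (∑ᶠ e ∈ {e : Sym2 HexVertex | e ∈ hexDomainBoundary Λ ∧ (δ : ℂ) * hexMidpoint e ∈ Metric.ball c r}, g ((δ : ℂ) * hexMidpoint e) * (hexParafermionicObservable Λ a hexCriticalFugacity 0 e / hexParafermionicObservable Λ a hexCriticalFugacity 0 b)) - (δ : ℂ) * (∑ᶠ e ∈ {e : Sym2 HexVertex | e ∈ hexDomainBoundary Λ' ∧ (δ : ℂ) * hexMidpoint e ∈ Metric.ball c r}, g ((δ : ℂ) * hexMidpoint e) * (hexParafermionicObservable Λ' a hexCriticalFugacity 0 e / hexParafermionicObservable Λ' a hexCriticalFugacity 0 b))‖ ≤ ε / (1 - ε) ^ 2 * ‖(δ : ℂ) * (∑ᶠ e ∈ {e : Sym2 HexVertex | e ∈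 hexDomainBoundary Λ' ∧ (δ : ℂ) * hexMidpoint e ∈ Metric.ball c r}, ((‖g ((δ : ℂ) * hexMidpoint e)‖ : ℝ) : ℂ) * (hexParafermionicObservable Λ' a hexCriticalFugacity 0 e / hexParafermionicObservable Λ' a hexCriticalFugacity 0 b))‖ :=
  fun _ _ _ _ _ _ _ _ _ _ g hδ hε₀ hε hpin hpin' hS hb hb₁ hb₂ hsand =>
    profile_pinch_at g hδ hε₀ hε hpin hpin' hS hb hb₁ hb₂ hsand

end Summit.CriticalPhenomena.SAWScalingLimit.Theorems.PolygonParitySqueeze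

end
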